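import Summits.AtomisticToContinuum.HydrodynamicLimit.Theses.AntiMazurCoboundaries
import Literature.MathematicalPhysics.KineticTheory.HardSphereEulerProofs
import Summits.AtomisticToContinuum.HydrodynamicLimit.Theorems.BoltzmannGreenKubo.Negative.PiStatics

/-!
# Exact equal-time Gibbs statics of one-body fields (stub `stub_gibbsStatics`, S2)

Stub `stub_gibbsStatics` of the line `two-level-corrector-ring-defect` of the crux
`AntiMazurCoboundaries.BoltzmannGreenKubo` (stmt-AtomisticToContinuum-13985). Under the constant-profile
hard-sphere Gibbs law `G_N = localGibbsLaw σ a u₀ θ N Φ` (`σ ≤ 1/2`, so that the partition function is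
positive, `posPartition_pos`):

* **product structure** (`localGibbsLaw_eq_map_zipConfig`, `measurePreserving_gibbsParam`): `G_N` is the
  image under `zipConfig` of `posGibbsMeasure ⊗ N(u₀, θ)^{⊗(N+1)}`, i.e. of `posGibbsMeasure ⊗ γ^{⊗(N+1)}`
  under `(x, w) ↦ (xᵢ, u₀ + √θ wᵢ)ᵢ` — the rescaled velocities `(vᵢ - u₀)/√θ` are i.i.d. standard Gaussian
  and independent of the positions (disintegration `lintegral_localGibbsMeasure`);
* **Haar one-particle marginal** (`map_eval_posGibbsMeasure`): the law of each `xᵢ` under the configurational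
  Gibbs measure is Haar — the hard-core weight is invariant under diagonal translations, so the marginal is a
  translation-invariant probability measure on the compact group `𝕋³` (`isAddInvariant_eq_smul_of_compactSpace`);
* **the identity** (`integral_field_mul_field`, `stub_gibbsStatics`): for centred `f₁, f₂ ∈ L²(γ)` and continuous
  `|φ| ≤ 1`, `∫ F_{f₁} F_{f₂} dG_N = (N+1) (∫ φ²) ⟨f₁, f₂⟩_γ` where `F_f(z) = Σᵢ φ(xᵢ) f((vᵢ - u₀)/√θ)`
  (cross terms vanish by independence of distinct particles, diagonal terms factorise), and `F_f ∈ L²(G_N)`.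

No definitions (pure-proof file). prover-line-stmt-AtomisticToContinuum-13985-0 (stub worker S2).
-/

noncomputable section

namespace Summit.AtomisticToContinuum.HydrodynamicLimit.Theorems

open MeasureTheory ProbabilityTheory Filter Topology Set
open Literature.Analysis.FluidPDE Literature.MathematicalPhysics.KineticTheory
open Literature.Analysis.UnboundedOperators
open scoped InnerProductSpace ENNReal
open BoltzmannGreenKuboOrthMomentum

namespace BoltzmannGreenKuboGibbsStatics

/-! ### Positions: diagonal translation invariance and the Haar one-particle marginal -/

section Positions

variable {n : ℕ}

/-- Diagonal translations preserve the Haar measure of `(𝕋³)ⁿ`. [folklore] -/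
theorem measurePreserving_addConst (c : T3) :
    MeasurePreserving (fun (x : Fin n → T3) (j : Fin n) => x j + c) volume volume :=
  measurePreserving_pi (fun _ : Fin n => (volume : Measure T3)) (fun _ => volume)
    (f := fun _ y => y + c) fun _ => measurePreserving_add_right volume c

/-- The hard-core position weight of a constant activity is invariant under diagonal translations
(the minimal-image distance only depends on differences). [folklore] -/
theorem posWeight_addConst (a ε : ℝ) (c : T3) (x : Fin n → T3) :
    posWeight (fun _ => a) ε n (fun j => x j + c) = posWeight (fun _ => a) ε n x := by
  have hmem : (fun j => x j + c) ∈ posDomain ε n ↔ x ∈ posDomain ε n := by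
    simp only [posDomain, mem_setOf_eq, Torus.euclidDist, add_sub_add_right_eq_sub]
  unfold posWeight
  by_cases hx : x ∈ posDomain ε n
  · rw [indicator_of_mem (hmem.2 hx), indicator_of_mem hx]
  · rw [indicator_of_notMem (mt hmem.1 hx), indicator_of_notMem hx]

/-- The density of the configurational Gibbs measure of a constant activity is measurable. [folklore] -/
theorem measurable_posDensity (a ε : ℝ) (n : ℕ) :
    Measurable fun x : Fin n → T3 =>
      ENNReal.ofReal ((posPartition (fun _ => a) ε n)⁻¹ * posWeight (fun _ => a) ε n x) :=
  (measurable_const.mul (measurable_posWeight continuous_const ε n)).ennreal_ofReal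

/-- The configurational Gibbs measure of a constant activity is invariant under diagonal translations.
[folklore] -/
theorem map_addConst_posGibbsMeasure (a ε : ℝ) (c : T3) :
    (posGibbsMeasure (fun _ => a) ε n).map (fun (x : Fin n → T3) (j : Fin n) => x j + c) =
      posGibbsMeasure (fun _ => a) ε n := by
  have hτ := measurePreserving_addConst (n := n) c
  ext s hs
  rw [Measure.map_apply hτ.measurable hs, posGibbsMeasure, withDensity_apply _ (hτ.measurable hs),
    withDensity_apply _ hs, ← lintegral_indicator (hτ.measurable hs), ← lintegral_indicator hs]
  have hind : (fun x : Fin n → T3 => ((fun (x : Fin n → T3) (j : Fin n) => x j + c) ⁻¹' s).indicator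
      (fun x => ENNReal.ofReal ((posPartition (fun _ => a) ε n)⁻¹ * posWeight (fun _ => a) ε n x)) x) =
      fun x => s.indicator
        (fun x => ENNReal.ofReal ((posPartition (fun _ => a) ε n)⁻¹ * posWeight (fun _ => a) ε n x))
        (fun j => x j + c) := by
    funext x
    by_cases hx : (fun j => x j + c) ∈ s
    · rw [indicator_of_mem hx, posWeight_addConst,
        indicator_of_mem (show x ∈ (fun (x : Fin n → T3) (j : Fin n) => x j + c) ⁻¹' s from hx)]
    · rw [indicator_of_notMem hx,
        indicator_of_notMem (show x ∉ (fun (x : Fin n → T3) (j : Fin n) => x j + c) ⁻¹' s from hx)]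
  rw [hind]
  exact hτ.lintegral_comp ((measurable_posDensity a ε n).indicator hs)

/-- **The one-particle position marginal of the hard-sphere configurational Gibbs measure is Haar**
(constant activity, `σ ≤ 1/2`): it is a translation-invariant probability measure on the compact
group `𝕋³`. [folklore] -/
theorem map_eval_posGibbsMeasure {σ : ℝ} (hσ : σ ≤ 1 / 2) {a : ℝ} (ha : 0 < a) (N : ℕ)
    (i : Fin (N + 1)) :
    (posGibbsMeasure (fun _ => a) (hsDiameter σ N) (N + 1)).map (fun x => x i) = volume := by
  haveI := isProbabilityMeasure_posGibbsMeasure (a₀ := fun _ => a) continuous_const (fun _ => ha) hσ N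
  set μ' := (posGibbsMeasure (fun _ => a) (hsDiameter σ N) (N + 1)).map (fun x => x i) with hμ'
  haveI : IsProbabilityMeasure μ' :=
    Measure.isProbabilityMeasure_map (measurable_pi_apply i).aemeasurable
  haveI : μ'.IsAddLeftInvariant := by
    refine ⟨fun c => ?_⟩
    rw [hμ', Measure.map_map (measurable_const_add c) (measurable_pi_apply i)]
    have hcomp : ((fun x : T3 => c + x) ∘ fun x : Fin (N + 1) → T3 => x i) =
        (fun x : Fin (N + 1) → T3 => x i) ∘ fun (x : Fin (N + 1) → T3) (j : Fin (N + 1)) => x j + c := by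
      funext x
      simp only [Function.comp_apply, add_comm]
    rw [hcomp, ← Measure.map_map (measurable_pi_apply i) (measurePreserving_addConst c).measurable,
      map_addConst_posGibbsMeasure]
  have h := Measure.isAddInvariant_eq_smul_of_compactSpace μ' volume
  have hc : μ'.addHaarScalarFactor volume = 1 := by
    have Z : μ' univ = (μ'.addHaarScalarFactor volume • (volume : Measure T3)) univ := by rw [← h]
    simp only [measure_univ, Measure.smul_apply, ENNReal.smul_def, smul_eq_mul, mul_one,
      ENNReal.one_eq_coe] at Z
    exact Z.symm
  rw [h, hc, one_smul]

end Positions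

/-! ### The product structure of the constant-profile Gibbs law -/

section ProductStructure

/-- **Product structure of the constant-profile local Gibbs law**: `G_N` is the image under `zipConfig`
of `posGibbsMeasure ⊗ N(u₀, θ)^{⊗(N+1)}` — positions and velocities are independent, the velocities
i.i.d. Gaussian (disintegration `lintegral_localGibbsMeasure`; `𝒵 = Z_pos`). [folklore] -/
theorem localGibbsLaw_eq_map_zipConfig {σ a θ : ℝ} (ha : 0 < a) (hθ : 0 < θ) (u₀ : V3) (N : ℕ)
    (Φ : HardSphereFlow (Torus.geometry (Fin 3)) (hsDiameter σ N) (N + 1)) :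
    localGibbsLaw σ (fun _ => a) (fun _ => u₀) (fun _ => θ) N Φ =
      ((posGibbsMeasure (fun _ => a) (hsDiameter σ N) (N + 1)).prod
        (Measure.pi fun _ : Fin (N + 1) => gaussMeasure u₀ θ)).map zipConfig := by
  rw [localGibbsLaw_eq]
  ext B hB
  have hB' : MeasurableSet (zipConfig ⁻¹' B) := hB.preimage measurable_zipConfig
  rw [Measure.map_apply measurable_zipConfig hB, ← lintegral_indicator_one hB,
    lintegral_localGibbsMeasure continuous_const continuous_const continuous_const
      (fun _ => ha.le) (fun _ => hθ) σ N (measurable_one.indicator hB),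
    canonicalPartition_eq_posPartition continuous_const continuous_const continuous_const
      (fun _ => ha.le) (fun _ => hθ),
    Measure.prod_apply hB', posGibbsMeasure,
    lintegral_withDensity_eq_lintegral_mul _ (measurable_posDensity a _ _)
      (measurable_measure_prodMk_left hB')]
  refine lintegral_congr fun x => ?_
  rw [Pi.mul_apply, ← lintegral_indicator_one (measurable_prodMk_left hB')]
  rfl

/-- The i.i.d. `N(u₀, θ)` velocities are the image of i.i.d. standard Gaussians under the particlewise
affine map `w ↦ u₀ + √θ w`. [folklore] -/
theorem measurePreserving_gaussShift_pi (u₀ : V3) (θ : ℝ) (n : ℕ) :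
    MeasurePreserving (fun (w : Fin n → V3) (i : Fin n) => u₀ + Real.sqrt θ • w i)
      (Measure.pi fun _ : Fin n => stdGaussian V3) (Measure.pi fun _ : Fin n => gaussMeasure u₀ θ) :=
  measurePreserving_pi (fun _ : Fin n => stdGaussian V3) (fun _ => gaussMeasure u₀ θ)
    (f := fun _ w => u₀ + Real.sqrt θ • w) fun _ => ⟨measurable_gaussShift u₀ θ, rfl⟩

/-- **The Gibbs law `G_N` is the image of `posGibbsMeasure ⊗ γ^{⊗(N+1)}`** under
`(x, w) ↦ (xᵢ, u₀ + √θ wᵢ)ᵢ` (`σ ≤ 1/2`): the rescaled velocities are i.i.d. standard Gaussian,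
independent of the positions. [folklore] -/
theorem measurePreserving_gibbsParam {σ : ℝ} (hσ : σ ≤ 1 / 2) {a θ : ℝ} (ha : 0 < a) (hθ : 0 < θ)
    (u₀ : V3) (N : ℕ) (Φ : HardSphereFlow (Torus.geometry (Fin 3)) (hsDiameter σ N) (N + 1)) :
    MeasurePreserving
      (fun p : (Fin (N + 1) → T3) × (Fin (N + 1) → V3) =>
        zipConfig (p.1, fun i => u₀ + Real.sqrt θ • p.2 i))
      ((posGibbsMeasure (fun _ => a) (hsDiameter σ N) (N + 1)).prod
        (Measure.pi fun _ : Fin (N + 1) => stdGaussian V3))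
      (localGibbsLaw σ (fun _ => a) (fun _ => u₀) (fun _ => θ) N Φ) := by
  haveI := isProbabilityMeasure_posGibbsMeasure (a₀ := fun _ => a) continuous_const (fun _ => ha) hσ N
  have h1 := (MeasurePreserving.id (posGibbsMeasure (fun _ => a) (hsDiameter σ N) (N + 1))).prod
    (measurePreserving_gaussShift_pi u₀ θ (N + 1))
  have h2 : MeasurePreserving zipConfig
      ((posGibbsMeasure (fun _ => a) (hsDiameter σ N) (N + 1)).prod
        (Measure.pi fun _ : Fin (N + 1) => gaussMeasure u₀ θ))
      (localGibbsLaw σ (fun _ => a) (fun _ => u₀) (fun _ => θ) N Φ) :=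
    ⟨measurable_zipConfig, (localGibbsLaw_eq_map_zipConfig ha hθ u₀ N Φ).symm⟩
  exact h2.comp h1

end ProductStructure

/-! ### Statics on the product space `μ ⊗ γ^{⊗n}` -/

section Statics

variable {n : ℕ} (μ : Measure (Fin n → T3)) [IsProbabilityMeasure μ]

/-- Each velocity `wᵢ` is standard Gaussian under `μ ⊗ γ^{⊗n}` (`μ` a probability measure). [folklore] -/
theorem measurePreserving_vel (i : Fin n) :
    MeasurePreserving (fun p : (Fin n → T3) × (Fin n → V3) => p.2 i)
      (μ.prod (Measure.pi fun _ : Fin n => stdGaussian V3)) (stdGaussian V3) :=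
  (measurePreserving_eval (fun _ : Fin n => stdGaussian V3) i).comp
    (measurePreserving_snd (μ := μ) (ν := Measure.pi fun _ : Fin n => stdGaussian V3))

/-- A bounded position factor times an `L²(γ)` velocity factor is in `L²(μ ⊗ γ^{⊗n})`. [folklore] -/
theorem memLp_term {φ : T3 → ℝ} (hφm : Measurable φ) (hφb : ∀ x, |φ x| ≤ 1) {f : V3 → ℝ}
    (hf : MemLp f 2 (stdGaussian V3)) (i j : Fin n) :
    MemLp (fun p : (Fin n → T3) × (Fin n → V3) => φ (p.1 i) * f (p.2 j)) 2
      (μ.prod (Measure.pi fun _ : Fin n => stdGaussian V3)) := by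
  have h1 : MemLp (fun p : (Fin n → T3) × (Fin n → V3) => φ (p.1 i)) ∞
      (μ.prod (Measure.pi fun _ : Fin n => stdGaussian V3)) :=
    memLp_top_of_bound (hφm.comp ((measurable_pi_apply i).comp measurable_fst)).aestronglyMeasurable 1
      (Eventually.of_forall fun p => by rw [Real.norm_eq_abs]; exact hφb _)
  have h2 : MemLp (fun p : (Fin n → T3) × (Fin n → V3) => f (p.2 j)) 2
      (μ.prod (Measure.pi fun _ : Fin n => stdGaussian V3)) :=
    hf.comp_measurePreserving (measurePreserving_vel μ j)
  exact h2.mul' h1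

/-- The one-body field `Σᵢ φ(xᵢ) f(wᵢ)` is in `L²(μ ⊗ γ^{⊗n})`. [folklore] -/
theorem memLp_field {φ : T3 → ℝ} (hφm : Measurable φ) (hφb : ∀ x, |φ x| ≤ 1) {f : V3 → ℝ}
    (hf : MemLp f 2 (stdGaussian V3)) :
    MemLp (fun p : (Fin n → T3) × (Fin n → V3) => ∑ i, φ (p.1 i) * f (p.2 i)) 2
      (μ.prod (Measure.pi fun _ : Fin n => stdGaussian V3)) :=
  memLp_finsetSum _ fun i _ => memLp_term μ hφm hφb hf i i

omit [IsProbabilityMeasure μ] in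
/-- Two distinct particles' velocities are independent under `γ^{⊗n}`. [folklore] -/
theorem integral_pi_mul_of_ne {i k : Fin n} (hik : i ≠ k) {f g : V3 → ℝ} (hf : Measurable f)
    (hg : Measurable g) :
    ∫ v, f (v i) * g (v k) ∂(Measure.pi fun _ : Fin n => stdGaussian V3) =
      (∫ w, f w ∂stdGaussian V3) * ∫ w, g w ∂stdGaussian V3 := by
  -- adapted from `BoltzmannGreenKuboQuadraticMazur.integral_pi_mul_of_ne` (Negative/QuadraticStatics.lean)
  have hind : iIndepFun (fun j (v : Fin n → V3) => v j) (Measure.pi fun _ : Fin n => stdGaussian V3) :=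
    iIndepFun_pi (X := fun _ => id) fun _ => aemeasurable_id
  have hpair : IndepFun (fun v : Fin n → V3 => f (v i)) (fun v => g (v k))
      (Measure.pi fun _ : Fin n => stdGaussian V3) :=
    (hind.indepFun hik).comp hf hg
  rw [hpair.integral_fun_mul_eq_mul_integral (hf.comp (measurable_pi_apply i)).aestronglyMeasurable
      (hg.comp (measurable_pi_apply k)).aestronglyMeasurable,
    integral_diag (stdGaussian V3) f hf i, integral_diag (stdGaussian V3) g hg k]

omit [IsProbabilityMeasure μ] in
/-- **Factorised two-point function of one term**:
`∫ φ(xᵢ)f₁(wᵢ) · φ(xⱼ)f₂(wⱼ) d(μ ⊗ γ^⊗) = (∫ φ(xᵢ)φ(xⱼ) dμ)(∫ f₁(wᵢ)f₂(wⱼ) dγ^⊗)`. [folklore] -/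
theorem integral_term_mul_term [SFinite μ] (φ : T3 → ℝ) (f₁ f₂ : V3 → ℝ) (i j : Fin n) :
    ∫ p, φ (p.1 i) * f₁ (p.2 i) * (φ (p.1 j) * f₂ (p.2 j))
        ∂(μ.prod (Measure.pi fun _ : Fin n => stdGaussian V3)) =
      (∫ x, φ (x i) * φ (x j) ∂μ) *
        ∫ w, f₁ (w i) * f₂ (w j) ∂(Measure.pi fun _ : Fin n => stdGaussian V3) := by
  rw [← integral_prod_mul (μ := μ) (ν := Measure.pi fun _ : Fin n => stdGaussian V3)
    (fun x : Fin n → T3 => φ (x i) * φ (x j)) (fun w : Fin n → V3 => f₁ (w i) * f₂ (w j))]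
  refine integral_congr_ae (Eventually.of_forall fun p => ?_)
  simp only
  ring

/-- **Exact statics on the product space**: if every one-particle marginal of `μ` is Haar and `f₁, f₂`
are centred in `L²(γ)`, then `∫ (Σᵢ φ(xᵢ)f₁(wᵢ))(Σⱼ φ(xⱼ)f₂(wⱼ)) d(μ ⊗ γ^{⊗n}) = n (∫ φ²) ⟨f₁, f₂⟩_γ`
(cross terms vanish by independence, diagonal terms factorise). [folklore] -/
theorem integral_field_mul_field (hμ : ∀ i : Fin n, μ.map (fun x => x i) = volume) {φ : T3 → ℝ}
    (hφm : Measurable φ) (hφb : ∀ x, |φ x| ≤ 1) {f₁ f₂ : V3 → ℝ} (hf₁m : Measurable f₁)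
    (hf₂m : Measurable f₂) (hf₁ : MemLp f₁ 2 (stdGaussian V3)) (hf₂ : MemLp f₂ 2 (stdGaussian V3))
    (hc₁ : ∫ v, f₁ v ∂(stdGaussian V3) = 0) :
    ∫ p, (∑ i, φ (p.1 i) * f₁ (p.2 i)) * (∑ i, φ (p.1 i) * f₂ (p.2 i))
        ∂(μ.prod (Measure.pi fun _ : Fin n => stdGaussian V3)) =
      n * (∫ x, φ x ^ 2) * ∫ v, f₁ v * f₂ v ∂(stdGaussian V3) := by
  have hint : ∀ i j, Integrable (fun p : (Fin n → T3) × (Fin n → V3) =>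
      φ (p.1 i) * f₁ (p.2 i) * (φ (p.1 j) * f₂ (p.2 j)))
      (μ.prod (Measure.pi fun _ : Fin n => stdGaussian V3)) :=
    fun i j => (memLp_term μ hφm hφb hf₁ i i).integrable_mul (memLp_term μ hφm hφb hf₂ j j)
  simp_rw [Finset.sum_mul_sum]
  rw [integral_finsetSum _ fun i _ => integrable_finsetSum _ fun j _ => hint i j]
  have hdiag : ∀ i, ∫ p, φ (p.1 i) * f₁ (p.2 i) * (φ (p.1 i) * f₂ (p.2 i))
      ∂(μ.prod (Measure.pi fun _ : Fin n => stdGaussian V3)) =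
      (∫ x, φ x ^ 2) * ∫ v, f₁ v * f₂ v ∂(stdGaussian V3) := by
    intro i
    rw [integral_term_mul_term, integral_diag (stdGaussian V3) (fun w => f₁ w * f₂ w) (hf₁m.mul hf₂m) i]
    congr 1
    rw [← hμ i, integral_map (measurable_pi_apply i).aemeasurable
      ((continuous_pow 2).measurable.comp hφm).aestronglyMeasurable]
    refine integral_congr_ae (Eventually.of_forall fun x => ?_)
    simp only [sq]
  have hoff : ∀ i j, i ≠ j → ∫ p, φ (p.1 i) * f₁ (p.2 i) * (φ (p.1 j) * f₂ (p.2 j))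
      ∂(μ.prod (Measure.pi fun _ : Fin n => stdGaussian V3)) = 0 := by
    intro i j hij
    rw [integral_term_mul_term, integral_pi_mul_of_ne hij hf₁m hf₂m, hc₁, zero_mul, mul_zero]
  have hi : ∀ i, ∫ p, ∑ j, φ (p.1 i) * f₁ (p.2 i) * (φ (p.1 j) * f₂ (p.2 j))
      ∂(μ.prod (Measure.pi fun _ : Fin n => stdGaussian V3)) =
      (∫ x, φ x ^ 2) * ∫ v, f₁ v * f₂ v ∂(stdGaussian V3) := by
    intro i
    rw [integral_finsetSum _ fun j _ => hint i j,
      Finset.sum_eq_single i (fun j _ hji => hoff i j (Ne.symm hji))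
        (fun h => (h (Finset.mem_univ i)).elim), hdiag]
  simp only [hi, Finset.sum_const, Finset.card_univ, Fintype.card_fin, nsmul_eq_mul]
  ring

end Statics

/-! ### The stub -/

/-- The one-body field `z ↦ Σᵢ φ(xᵢ) f((vᵢ - u₀)/√θ)` is measurable. [folklore] -/
theorem measurable_obs {N : ℕ} (θ : ℝ) (u₀ : V3) {φ : T3 → ℝ} (hφ : Measurable φ) {f : V3 → ℝ}
    (hf : Measurable f) :
    Measurable fun z : Config (N + 1) (Fin 3) T3 =>
      ∑ i, φ (z i).1 * f ((Real.sqrt θ)⁻¹ • ((z i).2 - u₀)) :=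
  Finset.measurable_sum _ fun i _ => (hφ.comp (measurable_pi_apply i).fst).mul
    (hf.comp (((measurable_pi_apply i).snd.sub_const u₀).fun_const_smul _))

/-- **S2 — exact equal-time Gibbs statics of one-body fields.** Under the constant-profile hard-sphere
Gibbs law `G_N` (`σ ≤ 1/2`) the rescaled velocities `(vᵢ - u₀)/√θ` are i.i.d. standard Gaussian and
independent of the positions, and the one-particle position marginal is Haar; hence for centred
`f₁, f₂ ∈ L²(γ)` and continuous `|φ| ≤ 1` the one-body fields `F_f = Σᵢ φ(xᵢ) f((vᵢ - u₀)/√θ)` are in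
`L²(G_N)` and `∫ F_{f₁} F_{f₂} dG_N = (N+1) (∫ φ²) ⟨f₁, f₂⟩_γ` exactly. [folklore] -/
theorem stub_gibbsStatics :
    ∀ (a θ σ : ℝ) (u₀ : V3), 0 < a → 0 < θ → 0 < σ → σ ≤ 1 / 2 →
    ∀ (φ : T3 → ℝ) (f₁ f₂ : V3 → ℝ), Continuous φ → (∀ x, |φ x| ≤ 1) →
      Measurable f₁ → Measurable f₂ → MemLp f₁ 2 (stdGaussian V3) → MemLp f₂ 2 (stdGaussian V3) →
      ∫ v, f₁ v ∂(stdGaussian V3) = 0 → ∫ v, f₂ v ∂(stdGaussian V3) = 0 →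
    ∀ (N : ℕ) (Φ : HardSphereFlow (Torus.geometry (Fin 3)) (hsDiameter σ N) (N + 1)),
      MemLp (fun z : Config (N + 1) (Fin 3) T3 =>
          ∑ i, φ (z i).1 * f₁ ((Real.sqrt θ)⁻¹ • ((z i).2 - u₀))) 2
        (localGibbsLaw σ (fun _ => a) (fun _ => u₀) (fun _ => θ) N Φ) ∧
      MemLp (fun z : Config (N + 1) (Fin 3) T3 =>
          ∑ i, φ (z i).1 * f₂ ((Real.sqrt θ)⁻¹ • ((z i).2 - u₀))) 2
        (localGibbsLaw σ (fun _ => a) (fun _ => u₀) (fun _ => θ) N Φ) ∧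
      ∫ z, (∑ i, φ (z i).1 * f₁ ((Real.sqrt θ)⁻¹ • ((z i).2 - u₀))) *
            (∑ i, φ (z i).1 * f₂ ((Real.sqrt θ)⁻¹ • ((z i).2 - u₀)))
          ∂(localGibbsLaw σ (fun _ => a) (fun _ => u₀) (fun _ => θ) N Φ) =
        (((N : ℝ)) + 1) * (∫ x, φ x ^ 2) * ∫ v, f₁ v * f₂ v ∂(stdGaussian V3) := by
  intro a θ σ u₀ ha hθ _hσ hσ2 φ f₁ f₂ hφ hφb hf₁m hf₂m hf₁ hf₂ hc₁ _hc₂ N Φ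
  haveI := isProbabilityMeasure_posGibbsMeasure (a₀ := fun _ => a) continuous_const (fun _ => ha) hσ2 N
  have hZ := measurePreserving_gibbsParam hσ2 ha hθ u₀ N Φ
  have hsθ : Real.sqrt θ ≠ 0 := (Real.sqrt_pos.2 hθ).ne'
  have hcomp : ∀ f : V3 → ℝ,
      ((fun z : Config (N + 1) (Fin 3) T3 => ∑ i, φ (z i).1 * f ((Real.sqrt θ)⁻¹ • ((z i).2 - u₀))) ∘
        fun p : (Fin (N + 1) → T3) × (Fin (N + 1) → V3) =>
          zipConfig (p.1, fun i => u₀ + Real.sqrt θ • p.2 i)) =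
      fun p => ∑ i, φ (p.1 i) * f (p.2 i) := by
    intro f
    funext p
    simp only [Function.comp_apply, zipConfig_apply, add_sub_cancel_left, inv_smul_smul₀ hsθ]
  have hmem : ∀ f : V3 → ℝ, Measurable f → MemLp f 2 (stdGaussian V3) →
      MemLp (fun z : Config (N + 1) (Fin 3) T3 =>
          ∑ i, φ (z i).1 * f ((Real.sqrt θ)⁻¹ • ((z i).2 - u₀))) 2
        (localGibbsLaw σ (fun _ => a) (fun _ => u₀) (fun _ => θ) N Φ) := by
    intro f hfm hf
    rw [← hZ.map_eq]
    refine (memLp_map_measure_iff (measurable_obs θ u₀ hφ.measurable hfm).aestronglyMeasurable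
      hZ.measurable.aemeasurable).2 ?_
    rw [hcomp f]
    exact memLp_field _ hφ.measurable hφb hf
  refine ⟨hmem f₁ hf₁m hf₁, hmem f₂ hf₂m hf₂, ?_⟩
  rw [← hZ.map_eq]
  have hFm : AEStronglyMeasurable (fun z : Config (N + 1) (Fin 3) T3 =>
      (∑ i, φ (z i).1 * f₁ ((Real.sqrt θ)⁻¹ • ((z i).2 - u₀))) *
        (∑ i, φ (z i).1 * f₂ ((Real.sqrt θ)⁻¹ • ((z i).2 - u₀))))
      (Measure.map (fun p : (Fin (N + 1) → T3) × (Fin (N + 1) → V3) =>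
          zipConfig (p.1, fun i => u₀ + Real.sqrt θ • p.2 i))
        ((posGibbsMeasure (fun _ => a) (hsDiameter σ N) (N + 1)).prod
          (Measure.pi fun _ : Fin (N + 1) => stdGaussian V3))) :=
    ((measurable_obs θ u₀ hφ.measurable hf₁m).mul
      (measurable_obs θ u₀ hφ.measurable hf₂m)).aestronglyMeasurable
  rw [integral_map hZ.measurable.aemeasurable hFm]
  have key := integral_field_mul_field (posGibbsMeasure (fun _ => a) (hsDiameter σ N) (N + 1))
    (map_eval_posGibbsMeasure hσ2 ha N) hφ.measurable hφb hf₁m hf₂m hf₁ hf₂ hc₁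
  rw [Nat.cast_succ] at key
  simp only [zipConfig_apply, add_sub_cancel_left, inv_smul_smul₀ hsθ]
  exact key

end BoltzmannGreenKuboGibbsStatics

end Summit.AtomisticToContinuum.HydrodynamicLimit.Theorems

end
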